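import Summits.Ventures.GridStability.Models.SMIB
import Summits.Ventures.GridStability.Models.InverterInstances

/-!
# G3.a instance of record «GFM-SMIB-QoriaV4» (droop grid-forming VSC against an infinite bus ≡ SMIB)

Venture GRIDFUSION, cell `run/shared/lean/pub/gridfusion/`, rung G3.a (PARTITION A18 = director
RULING 16 (a); A19 + second addendum = LEAD RULING 2026-08-26T20:46:20Z); seat gridfusion-model-1
(SMIB-instance decls, the `SMIBInstances.lean` pattern); DATA custody gridfusion-model-4
(`bench/data/GFM-SMIB/params.json` a0e6894da9d00899, `PROVENANCE.md` ce9fff9bfa985a81); converter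
gains gridfusion-model-3 (INBOX 20:35:23Z); MODEL-VALIDITY row and tokens gridfusion-model-2 (v0.14,
MV-Ω addendum option (A′)).

SOURCE AS PRINTED (read on the page by model-4, lit-2 §1b and model-3; locators theirs): T. Qoria,
*Grid-forming control to achieve a 100% power electronics interfaced power transmission systems*,
PhD thesis, HESAM/ENSAM 2020 (tel-03078479) [paper:galaxy-pdf-947812980]: quasi-static droop-VSC vs
grid, `p_mes = P_max sin δ_m` (V-13), `P_max = V_mV_e/(X_c + X_g)` (V-14) with `V_m = V_e = 1`
(Table III-1 p0058), `X_c = 0.15` (Table II-2 p0040), `SCR = 10`, `X_g = 1/SCR` (Table V-1 p0103,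
(II-3) p0035) ⇒ `P_max = 4` EXACTLY; operating point `p* = 0.5`, `H_VSC = 5 s` (§V.4 p0108 L11);
frequency law `(ω_b/(k_iω_c)) dω_m/dt = p* − p_mes − (ω_b/k_i)(ω_m − ω_set)` (III-46),
`H = ω_b/(2ω_ck_i)` (III-22); couple of record `ω_c = 33 rad/s`, `k_i = ω_b/330` (§III.4.2.2 p0067
L24 read so that `H_VSC = 5 s` exactly — model-3; PROVENANCE row: the §III design couple is ASSUMED
carried into §V.4, whose parameter-table rows are an image in the held copy).

THE MODEL. By model-3's kernel identification (`InverterBridgesSMIB.lean` p462458,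
`InverterDroop.ReducedParams` → `SMIB`) the reduced droop-GFM model IS model-1's `SMIB` with
`M = 1/(k_iω_c)`, `D = 1/k_i`, `P_m = p*`, `P_C = 0`, `P_M = P_max`, `γ = 0`, state `(δ, ω_b(ω − ω_e))`.
Equilibrium per A1″ (eq=b): `sin δ_0 = p*/P_max = 1/8` has irrational cosine, so the equilibrium is
FIXED at the smallest-height admissible circle point `t = 255/4064`:
`(s*, c*) = (2072640/16581121, 16451071/16581121)`, set-point REDEFINED `p*′ = P_max s* =
8290560/16581121` (`p*′ − p* = −1/33162242 ≈ −3.0e-8 < 5e-6`; MODELLED, MV-P).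

INSTANCE OF RECORD = option (A′) SCALED TIME (lead 20:46:20Z; model-2 MV-Ω addendum): time unit
`T = 1/√(k_iω_c P_max) = 1/√(40π) s ≈ 0.0892 s`, `τ = t/T`, speed `ω̂ = T·ω`; then
`M_τ = M/T² = P_max = 4` and the stiffness is EXACT (`a_τ = P_M c*/M_τ = c*`, `b_τ = s*`), while the
dimensionless damping `d̃ = D T/M = ω_c T = 33/√(40π) = 2.94380479…` is irrational and is DECLARED as
the rational token of record `d̃′ = 2043/694` (`|Δ| = 7.6e-7`, `|Δ|/d̃ = 2.6e-7 < 5e-6`; MODELLED token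
«MV-6D+MV-P+MV-Ω(τ: T = 1/√(40π) s; d̃′ = 2043/694)»): `gfmQoriaV4` below, `D_τ = 4·d̃′ = 4086/347`,
recast field `fGfmQoriaV4 = SMIB.polyField c* s* (2043/694)` (header of record: inst=GFM-SMIB-QoriaV4
t=255/4064 d=2043/694). Durations read off a τ-certificate are `× T`.
SIBLING «GFM-SMIB-QoriaV4-phys» (MODELLED, NOT of record; model-4 v1 block, MV-Ω option (B) surrogate
`ω_b′ = 35500/113` for `100π`, `|Δ|/ω_b = 8.5e-8`): physical time, `M = 10/ω_b′ = 113/3550`,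
`D = 330/ω_b′ = 3729/3550`, recast `a = 233605208200/1873666673`, `b = 29431488000/1873666673`,
`d = 33`: `gfmQoriaV4Phys`, `fGfmQoriaV4Phys` (the converter-side typing of THIS sibling, in gains
`(ω_b′, ω_c, k_i) = (35500/113, 33, 3550/3729)`, is model-3's `InverterDroop.gfmSmibQoriaV4`, staged
`InverterInstances.lean` ad3af7335b9fa2ce, whose `rel_a/rel_b/rel_d` re-derive the same `(a, b, d)` and
whose `toGridSMIB` has `M = 113/3550`, `D = 3729/3550`). The two records are NOT exact time-scalings of each
other (each carries its own declared surrogate); `SMIB.timeScale` / `IsSolutionOn.timeScale` below is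
the exact unit-change statement behind option (A)/(A′) («scaled time is a change of units: solutions
correspond one-to-one, angle sets unchanged, speeds × T»).

This file discharges, for both records, every side hypothesis of `SMIB.hasDerivWithinAt_embed`
(`δ^s := arcsin s*`, `sin δ^s = s*`, `cos δ^s = c*` EXACTLY), so the chain rule along solutions holds
with no hypotheses left (input of a G3.a `…Roa` companion via `Lyapunov/CertificateSoundness.lean`;
model-3's transport `InverterDroopSMIBRoa.lean` pattern carries it back to converter variables).
MODELLED: reduced-order GFM, inner loops / current limitation / virtual impedance / PLL absent,
infinite bus (model-2 row MV-6D; Qoria §V.3 assumptions p0103 L27). VALIDATED comparators printed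
(never certified): `t_c = 350 ms` (`H ≈ 0`) / `498 ms` (`H = 5 s`) at `p* = 0.5` (p0108 L19).
CERTIFIED: nothing here. No declaration says a converter or grid is stable.
-/

noncomputable section

open Real
open Literature.Computation.Certificates
open Literature.Computation.Certificates.SOS

namespace Summit.Ventures.GridStability.Models

namespace SMIB

/-! ### Scaled time is a change of units (MV-Ω option (A)/(A′), exact) -/

variable (p : SMIB)

/-- The same machine read in the time unit `T` (`τ = t/T`, speed `ω̂ = dδ/dτ = T·ω`):
`M ↦ M/T²`, `D ↦ D/T`, powers and angles unchanged. -/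
def timeScale (T : ℝ) : SMIB where
  M := p.M / T ^ 2
  D := p.D / T
  Pm := p.Pm
  PC := p.PC
  PM := p.PM
  γ := p.γ

/-- The power–angle curve does not depend on the time unit. -/
@[simp] theorem timeScale_Pe (T δ : ℝ) : (p.timeScale T).Pe δ = p.Pe δ := rfl

/-- Equilibrium angles do not depend on the time unit. -/
theorem timeScale_isEquilibrium_iff (T δs : ℝ) :
    (p.timeScale T).IsEquilibrium δs ↔ p.IsEquilibrium δs := Iff.rfl

/-- **Scaled time is a change of units (exact).** If `c = (δ, ω)` solves `M_smib(p)` on the time set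
`s`, then `τ ↦ (δ(Tτ), T·ω(Tτ))` solves `M_smib(p.timeScale T)` on `{τ | Tτ ∈ s}` (`T ≠ 0`, `M ≠ 0`):
angles (hence every angle set, arc condition and limit) are unchanged, speeds are multiplied by `T`,
durations divided by `T`. -/
theorem IsSolutionOn.timeScale {c : ℝ → ℝ × ℝ} {s : Set ℝ} (hc : p.IsSolutionOn c s) {T : ℝ}
    (hT : T ≠ 0) (hM : p.M ≠ 0) :
    (p.timeScale T).IsSolutionOn (fun τ => ((c (T * τ)).1, T * (c (T * τ)).2))
      ((fun τ => T * τ) ⁻¹' s) := by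
  intro τ hτ
  have h := hc (T * τ) hτ
  have hg : HasDerivWithinAt (fun τ' : ℝ => T * τ') T ((fun τ' => T * τ') ⁻¹' s) τ := by
    simpa using ((hasDerivAt_id τ).const_mul T).hasDerivWithinAt
  have hcomp : HasDerivWithinAt (fun τ' => c (T * τ')) (T • p.field (c (T * τ)))
      ((fun τ' => T * τ') ⁻¹' s) τ :=
    h.scomp τ hg (Set.mapsTo_preimage _ _)
  have h1 : HasDerivWithinAt (fun τ' => (c (T * τ')).1) (T * (c (T * τ)).2)
      ((fun τ' => T * τ') ⁻¹' s) τ := by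
    have := hcomp.hasFDerivWithinAt.fst.hasDerivWithinAt
    simpa [field] using this
  have h2 : HasDerivWithinAt (fun τ' => (c (T * τ')).2)
      (T * ((p.Pm - p.Pe (c (T * τ)).1 - p.D * (c (T * τ)).2) / p.M))
      ((fun τ' => T * τ') ⁻¹' s) τ := by
    have := hcomp.hasFDerivWithinAt.snd.hasDerivWithinAt
    simpa [field] using this
  have h2' := h2.const_mul T
  refine (h1.prodMk h2').congr_deriv ?_
  simp only [SMIB.field, SMIB.Pe, SMIB.timeScale]
  refine Prod.ext rfl ?_
  dsimp only
  field_simp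

/-! ### The instance of record «GFM-SMIB-QoriaV4» (scaled time, option (A′)) -/

/-- `s* = sin δ*` of record for «GFM-SMIB-QoriaV4» (A1″ smallest-height admissible `t = 255/4064`). -/
def sQV4 : ℚ := 2072640 / 16581121

/-- `c* = cos δ*` of record for «GFM-SMIB-QoriaV4». -/
def cQV4 : ℚ := 16451071 / 16581121

/-- The circle point is exact: `s*² + c*² = 1`. -/
theorem sQV4_sq_add_cQV4_sq : sQV4 ^ 2 + cQV4 ^ 2 = 1 := by norm_num [sQV4, cQV4]

/-- The REDEFINED set-point `p*′ = P_max s* = 8290560/16581121` (`P_max = 4`; `p*′ − 1/2 = −1/33162242`). -/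
theorem pStar_eq : (8290560 : ℚ) / 16581121 = 4 * sQV4 ∧
    (8290560 : ℚ) / 16581121 - 1 / 2 = -1 / 33162242 := by
  constructor <;> norm_num [sQV4]

/-- Declared dimensionless damping token of record `d̃′ = 2043/694` (for `d̃ = ω_c T = 33/√(40π)`). -/
def dQV4 : ℚ := 2043 / 694

/-- INSTANCE OF RECORD «GFM-SMIB-QoriaV4» in SCALED TIME `τ = t/T`, `T = 1/√(40π)` s (option (A′)):
`M_τ = M/T² = P_max = 4`, `D_τ = P_max·d̃′ = 4086/347`, `P_m = p*′ = 8290560/16581121`, `P_C = 0`,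
`P_M = P_max = 4`, `γ = 0`; state `(δ, ω̂)` with `ω̂ = T·ω_b(ω_m − ω_e)`. MODELLED token
«MV-6D+MV-P+MV-Ω(τ: T = 1/√(40π) s; d̃′ = 2043/694)». -/
def gfmQoriaV4 : SMIB where
  M := 4
  D := (4086 : ℝ) / 347
  Pm := (8290560 : ℝ) / 16581121
  PC := 0
  PM := 4
  γ := 0

/-- SIBLING «GFM-SMIB-QoriaV4-phys» (MODELLED, NOT of record): physical time with the declared surrogate
`ω_b′ = 35500/113`: `M = 1/(k_iω_c) = 10/ω_b′ = 113/3550`, `D = 1/k_i = 330/ω_b′ = 3729/3550`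
(so `D/M = 33 = ω_c`; model-4's INBOX line 20:41:41Z prints «3729/35500», an arithmetic slip caught by
the kernel check of `gfmQoriaV4Phys_relations` — the data file states `D = 330/ω_b′` symbolically),
`P_m = p*′`, `P_C = 0`, `P_M = 4`, `γ = 0`; token «MV-6D+MV-P+MV-Ω(ω_b′ = 35500/113)». -/
def gfmQoriaV4Phys : SMIB where
  M := (113 : ℝ) / 3550
  D := (3729 : ℝ) / 3550
  Pm := (8290560 : ℝ) / 16581121
  PC := 0
  PM := 4
  γ := 0

/-- Physical-time recast coefficient `a = P_M c*/M = (14200/113)·c*` of the sibling. -/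
def aQV4phys : ℚ := 233605208200 / 1873666673

/-- Physical-time recast coefficient `b = P_M s*/M = (14200/113)·s*` of the sibling. -/
def bQV4phys : ℚ := 29431488000 / 1873666673

/-- The equilibrium angle of record `δ* := arcsin s*` (`≈ 0.1253278 rad`; the printed
`δ_0 = arcsin(1/8)` differs by `7.6e-9` rad — VALIDATED comparison only). -/
def deltaQV4 : ℝ := arcsin (sQV4 : ℝ)

/-- `sin δ* = s*` exactly. -/
theorem sin_deltaQV4 : sin deltaQV4 = (sQV4 : ℝ) := by
  rw [deltaQV4, sin_arcsin] <;> norm_num [sQV4]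

/-- `cos δ* = c*` exactly (`cos ∘ arcsin = √(1 − s²)`, `1 − s*² = c*²`, `c* > 0`). -/
theorem cos_deltaQV4 : cos deltaQV4 = (cQV4 : ℝ) := by
  rw [deltaQV4, cos_arcsin]
  have h : (1 : ℝ) - (sQV4 : ℝ) ^ 2 = (cQV4 : ℝ) ^ 2 := by norm_num [sQV4, cQV4]
  rw [h, sqrt_sq]
  norm_num [cQV4]

/-- `δ*` is an equilibrium of «GFM-SMIB-QoriaV4» (this is the DEFINITION of `p*′`, A1″ eq=b). -/
theorem gfmQoriaV4_isEquilibrium : gfmQoriaV4.IsEquilibrium deltaQV4 := by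
  rw [isEquilibrium_iff]
  simp only [gfmQoriaV4, sub_zero, sin_deltaQV4, sQV4]
  norm_num

/-- `δ*` is an equilibrium of the physical-time sibling. -/
theorem gfmQoriaV4Phys_isEquilibrium : gfmQoriaV4Phys.IsEquilibrium deltaQV4 := by
  rw [isEquilibrium_iff]
  simp only [gfmQoriaV4Phys, sub_zero, sin_deltaQV4, sQV4]
  norm_num

/-- The A1 data relations for the instance of record: `a_τ = P_M cos(δ* − γ)/M_τ = c*`,
`b_τ = P_M sin(δ* − γ)/M_τ = s*`, `d = D_τ/M_τ = d̃′ = 2043/694`. -/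
theorem gfmQoriaV4_relations :
    ((cQV4 : ℚ) : ℝ) = gfmQoriaV4.PM * cos (deltaQV4 - gfmQoriaV4.γ) / gfmQoriaV4.M ∧
    ((sQV4 : ℚ) : ℝ) = gfmQoriaV4.PM * sin (deltaQV4 - gfmQoriaV4.γ) / gfmQoriaV4.M ∧
    ((dQV4 : ℚ) : ℝ) = gfmQoriaV4.D / gfmQoriaV4.M := by
  refine ⟨?_, ?_, ?_⟩
  · simp only [gfmQoriaV4, sub_zero, cos_deltaQV4, cQV4]; norm_num
  · simp only [gfmQoriaV4, sub_zero, sin_deltaQV4, sQV4]; norm_num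
  · simp only [gfmQoriaV4, dQV4]; norm_num

/-- The A1 data relations for the physical-time sibling: `(a, b, d) = (aQV4phys, bQV4phys, 33)`. -/
theorem gfmQoriaV4Phys_relations :
    ((aQV4phys : ℚ) : ℝ) = gfmQoriaV4Phys.PM * cos (deltaQV4 - gfmQoriaV4Phys.γ) / gfmQoriaV4Phys.M ∧
    ((bQV4phys : ℚ) : ℝ) = gfmQoriaV4Phys.PM * sin (deltaQV4 - gfmQoriaV4Phys.γ) / gfmQoriaV4Phys.M ∧
    (((33 : ℚ)) : ℝ) = gfmQoriaV4Phys.D / gfmQoriaV4Phys.M := by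
  refine ⟨?_, ?_, ?_⟩
  · simp only [gfmQoriaV4Phys, sub_zero, cos_deltaQV4, aQV4phys, cQV4]; norm_num
  · simp only [gfmQoriaV4Phys, sub_zero, sin_deltaQV4, bQV4phys, sQV4]; norm_num
  · simp only [gfmQoriaV4Phys]; norm_num

/-- The recast field OF RECORD for G3.a: `polyField c* s* d̃′` in the variables
`(σ, κ, ω̂) = (sin(δ − δ*), 1 − cos(δ − δ*), T·ω)` — the `f` the unchanged SMIB programme certifies
(header inst=GFM-SMIB-QoriaV4 t=255/4064 d=2043/694; I2 mirror `models/GFM-SMIB-poly.json`). -/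
def fGfmQoriaV4 : List Poly := polyField cQV4 sQV4 dQV4

/-- The recast field of the physical-time sibling «GFM-SMIB-QoriaV4-phys» (`ω` in rad/s). -/
def fGfmQoriaV4Phys : List Poly := polyField aQV4phys bQV4phys 33

/-- **Hypothesis-free chain rule for the instance of record.** Along every solution `c` of
«GFM-SMIB-QoriaV4» (scaled time) on `s`, the recast coordinates `z = embed δ* (c τ)` satisfy
`dz_k/dτ = f_k(z)` within `s`, `k = 0, 1, 2`, with `f = fGfmQoriaV4`. -/
theorem gfmQoriaV4_hasDerivWithinAt_embed {c : ℝ → ℝ × ℝ} {s : Set ℝ}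
    (hc : gfmQoriaV4.IsSolutionOn c s) {t : ℝ} (ht : t ∈ s) (k : Fin 3) :
    HasDerivWithinAt (fun τ => embed deltaQV4 (c τ) k)
      ((fGfmQoriaV4.getD k []).eval (embed deltaQV4 (c t))) s t := by
  obtain ⟨ha, hb, hd⟩ := gfmQoriaV4_relations
  have hM : gfmQoriaV4.M ≠ 0 := by simp only [gfmQoriaV4]; norm_num
  exact gfmQoriaV4.hasDerivWithinAt_embed hM ha hb hd gfmQoriaV4_isEquilibrium hc ht k

/-- Hypothesis-free chain rule for the physical-time sibling «GFM-SMIB-QoriaV4-phys». -/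
theorem gfmQoriaV4Phys_hasDerivWithinAt_embed {c : ℝ → ℝ × ℝ} {s : Set ℝ}
    (hc : gfmQoriaV4Phys.IsSolutionOn c s) {t : ℝ} (ht : t ∈ s) (k : Fin 3) :
    HasDerivWithinAt (fun τ => embed deltaQV4 (c τ) k)
      ((fGfmQoriaV4Phys.getD k []).eval (embed deltaQV4 (c t))) s t := by
  obtain ⟨ha, hb, hd⟩ := gfmQoriaV4Phys_relations
  have hM : gfmQoriaV4Phys.M ≠ 0 := by simp only [gfmQoriaV4Phys]; norm_num
  exact gfmQoriaV4Phys.hasDerivWithinAt_embed hM ha hb hd gfmQoriaV4Phys_isEquilibrium hc ht k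

/-- `f_ω` of the instance of record IS the `ω̂̇` of the model on the embedding (no hypotheses). -/
theorem gfmQoriaV4_fω_eval_embed (x : ℝ × ℝ) :
    (fω cQV4 sQV4 dQV4).eval (embed deltaQV4 x) = (gfmQoriaV4.field x).2 := by
  obtain ⟨ha, hb, hd⟩ := gfmQoriaV4_relations
  have hM : gfmQoriaV4.M ≠ 0 := by simp only [gfmQoriaV4]; norm_num
  exact gfmQoriaV4.fω_eval_embed hM ha hb hd gfmQoriaV4_isEquilibrium x

/-! ### Record status (PARTITION A19 third addendum) and the converter-side twin — APPEND 2026-08-26T21:57Z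

ERRATUM to the module docstring and to the docstrings of `gfmQoriaV4` / `fGfmQoriaV4` / `dQV4` above
(wording only; accepted declarations are never renamed): by the lead's REVISED ruling 21:11:37Z (director
concur 21:12:51Z; lead 21:20:32Z / 21:26:48Z; PARTITION A19 third addendum) the G3.a INSTANCE OF RECORD
«GFM-SMIB-QoriaV4» is the PHYSICAL-time reading — here `gfmQoriaV4Phys` / `fGfmQoriaV4Phys`
(`(a, b, d) = (233605208200/1873666673, 29431488000/1873666673, 33)`, token «MV-6D+MV-P+MV-Ω(ω_b′ =
35500/113)»), whose converter-side typed home is model-3's `InverterDroop.gfmSmibQoriaV4`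
(`InverterInstances.lean` p469363) — the two records are the SAME `SMIB` (`gfmQoriaV4Phys_eq_toGridSMIB`
below, by `norm_num`) with the same equilibrium angle (`deltaQV4_eq`); the A file of record
`cert/A/GFM-SMIB-deg2-A-QoriaV4phys.json` 6edf2c8094045e51 carries `fGfmQoriaV4Phys` verbatim (sos-1 diff
PASS against `models/GFM-SMIB-poly.json` 57c570f6fb9047fd). The scaled-time record `gfmQoriaV4` /
`fGfmQoriaV4` (`(c*, s*, 2043/694)`) is the «+» SIBLING (τ rows 6abd27d071903679 …), not of record.
The literal forms `fGfmQoriaV4Phys_eq` / `fGfmQoriaV4_eq` serve the Bench/Roa files (`rw`, then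
`simp [Poly.eval_cons, …]`). -/

/-- **The two typed homes agree.** Model-3's converter record of «GFM-SMIB-QoriaV4» (gains
`ω_b′ = 35500/113`, `ω_c = 33`, `k_i = 3550/3729`, `p*′`, `P_max = 4`), read as an SMIB through
`InverterDroop.ReducedParams.toGridSMIB` (`M = 1/(k_iω_c)`, `D = 1/k_i`), IS `gfmQoriaV4Phys`
(`M = 113/3550`, `D = 3729/3550`, `P_m = 8290560/16581121`, `P_C = 0`, `P_M = 4`, `γ = 0`). -/
theorem gfmQoriaV4Phys_eq_toGridSMIB : InverterDroop.gfmSmibQoriaV4.toGridSMIB = gfmQoriaV4Phys := by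
  simp only [InverterDroop.ReducedParams.toGridSMIB, InverterDroop.gfmSmibQoriaV4, gfmQoriaV4Phys,
    SMIB.mk.injEq]
  norm_num

/-- The equilibrium angles of the two typed homes coincide: `deltaQV4 = arcsin s* = gfmSmibQoriaV4_δs`. -/
theorem deltaQV4_eq : deltaQV4 = InverterDroop.gfmSmibQoriaV4_δs := by
  simp only [deltaQV4, InverterDroop.gfmSmibQoriaV4_δs, sQV4]
  norm_num

/-- Hence every solution of model-3's converter-derived SMIB is a solution of `gfmQoriaV4Phys` and the
hypothesis-free chain rule `gfmQoriaV4Phys_hasDerivWithinAt_embed` applies to it verbatim. -/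
theorem toGridSMIB_hasDerivWithinAt_embed {c : ℝ → ℝ × ℝ} {s : Set ℝ}
    (hc : InverterDroop.gfmSmibQoriaV4.toGridSMIB.IsSolutionOn c s) {t : ℝ} (ht : t ∈ s) (k : Fin 3) :
    HasDerivWithinAt (fun τ => embed deltaQV4 (c τ) k)
      ((fGfmQoriaV4Phys.getD k []).eval (embed deltaQV4 (c t))) s t :=
  gfmQoriaV4Phys_hasDerivWithinAt_embed (by rwa [gfmQoriaV4Phys_eq_toGridSMIB] at hc) ht k

/-- **Field of record as a literal** (INSTANCE OF RECORD «GFM-SMIB-QoriaV4», physical time; variables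
`σ, κ, ω ↦ 0, 1, 2`): `fGfmQoriaV4Phys = [σ̇, κ̇, ω̇]` with `ω̇ = −aσ + bκ − 33ω`. -/
theorem fGfmQoriaV4Phys_eq : fGfmQoriaV4Phys =
    [ [(([0, 0, 1] : List ℕ), (1 : ℚ)), (([0, 1, 1] : List ℕ), (-1 : ℚ))],
      [(([1, 0, 1] : List ℕ), (1 : ℚ))],
      [(([1] : List ℕ), ((-233605208200 : ℚ) / 1873666673)),
       (([0, 1] : List ℕ), ((29431488000 : ℚ) / 1873666673)),
       (([0, 0, 1] : List ℕ), (-33 : ℚ))] ] := by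
  decide +kernel

/-- The scaled-time sibling's field as a literal: `fGfmQoriaV4 = [σ̇, κ̇, ω̂̇]` with
`ω̂̇ = −c*σ + s*κ − (2043/694)ω̂`. -/
theorem fGfmQoriaV4_eq : fGfmQoriaV4 =
    [ [(([0, 0, 1] : List ℕ), (1 : ℚ)), (([0, 1, 1] : List ℕ), (-1 : ℚ))],
      [(([1, 0, 1] : List ℕ), (1 : ℚ))],
      [(([1] : List ℕ), ((-16451071 : ℚ) / 16581121)),
       (([0, 1] : List ℕ), ((2072640 : ℚ) / 16581121)),
       (([0, 0, 1] : List ℕ), ((-2043 : ℚ) / 694))] ] := by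
  decide +kernel

end SMIB

end Summit.Ventures.GridStability.Models
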